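import Summits.HodgeConjecture.HodgeConjecture.Theorems.F0LD1ThetaClassFinSliceFinite
import Literature.NumberTheory.Automorphic.AutomorphicSpectrum
import HarnessLib

-- statements over the theta-kernel datum elaborate to very large types; elaborate sequentially (as in the ★ kit lineage)
set_option Elab.async false

/-!
# Crux `HLiu418`, line LD1, organ (Gα) — brick (Gα-Cf) `FinGeneration`, CORE: FINITE-ADELIC GENERATION THROUGH A CLOSED INVARIANT
# SUBSPACE from «irreducible or zero» of the `ξ_f`-coinvariants (generic rank `N`, abstract transport `ιA` with a surjective finite part)

Cell hodgecm-mathlib (D-0151), FLOOR 0; crux item `HLiu418` = stmt-HodgeConjecture-24832; half-A line LD1 (socket `stub_S1_facts`, #73 E1θhol; leaf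
`Cruxes/HLiu418/Lines/F0_P6LD_StubS1FactsThetaRoad.lean`), organ (Gα) `F0LD1ThetaGermDefs.ThetaDichotomy₂`, brick **(Gα-Cf) `FinGeneration`** of
LD1-plan (g2)'s bricks leaf `Theorems/F0LD1ThetaDichotomyBricks.lean` (DEALS #9 (a) → seat A-p13 (g40)).  THEOREMS ONLY (no `def`, no instance, no notation, no
named fact, no `sorry`); `--supports stmt-HodgeConjecture-24832 --as helper`.  Namespace `…Cruxes.HLiu418.F0LD1ThetaFinGeneration`, shared with the closer
`Theorems/F0LD1ThetaFinGeneration.lean` (`finGeneration_holds : F0LD1ThetaDichotomyBricks.FinGeneration`, which imports this file, ★ the bricks leaf and ★ the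
character-generic irreducibility twin of A-p12 (g27)).

WHAT.  The CM line frame of ★ `F0LD2ThetaTensorClasses` §2 ∕ ★ `F0LD1ThetaClassFinSliceFinite`: `L` CM, `H ∈ M_N(L)`, real non-zero diagonal `dV`, an
abstract continuous transport `ιA : U(H)(𝔸) →* U(diag dV)(𝔸)` carrying rational points to rational points (`hιA`), whose finite part
`k ↦ (ιA (1,k))_f` is finite-adelic (`hιAf`) and SURJECTIVE (`hsurj` — for the PINNED transport of the LD organs both follow from ★ `F0LD2FrameTransportPin`),
the conjugate-symplectic `μ`, the line `⟨a⟩`, majorants `hρ`, a finite invariant `μW` on `[U(⟨a⟩)]`, an automorphic measure `ν` on `[U(H)]`, and ANY continuous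
unitary character `ξ` of `[U(⟨a⟩)]`.  Classes `[Θ̃_{R_e E(φ ⊗ Φ_f)}(ξ) ∘ ιA] ∈ L²([U(H)], ν)` for archimedean `φ` and finite `Φ_f ∈ 𝒮((𝔸_{L⁺,f})^{N×1})`.

* `toLp_lineThetaLift_tensor_mem_of_isIrreducibleOrZero` — IF the `χ′_ξ`-coinvariants `Ω(s_a, χ′_ξ)` of the finite Weil representation at the
  χ-splitting are «irreducible or zero» for every continuous unitary `χ′` (hypothesis `hirr`; the character-generic twin of ★
  `isIrreducibleOrZero_rhoVAtLine_chiSplittingLine`, landed separately by A-p12 (g27) as `isIrreducibleOrZero_weilCoinv_chiSplittingLine_of_continuous`),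
  and the finite datum `Φ_f⁰` carries a NON-ZERO class for SOME archimedean `ψ`, and `[Θ̃_{R_e E(φ ⊗ Φ_f⁰)}(ξ) ∘ ιA]` lies in a closed `R`-invariant
  `Q ⊆ L²([U(H)])`, THEN `[Θ̃_{R_e E(φ ⊗ Φ_f)}(ξ) ∘ ιA] ∈ Q` for EVERY `Φ_f`.

PROOF (kernel; [Liu2021, proof of Prop. 4.13 Case 1] ∕ [Rallis1984, Thm. 1.2.2] «the finite component of a global theta lift is a quotient of the
coinvariants of `ω_f`», read as a GENERATION statement).  `χ′_ξ := ξ([·])` on `U(⟨a⟩)(𝔸_f)` (unitary, continuous — ★ `F0LD1ThetaClassFinSliceFinite` §2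
pattern).  The class map `cls φ : Φ_f ↦ [Θ̃_{R_e E(φ ⊗ Φ_f)}(ξ) ∘ ιA]` is linear (★ `toLp_lineThetaLift_tensor_add ∕ _smul`) and `χ′_ξ`-covariant (★
`toLp_lineThetaLift_tensor_finPairRep_one_charCM`).  `R` is unitary (★ `AdelicGroupData.isUnitary_rightRegular`), so `Qᗮ` is a closed subrepresentation and the
orthogonal projection `P_{Qᗮ}` commutes with every `R(γ)` (Mathlib `Submodule.eq_starProjection_of_mem_orthogonal`: `Qᗮ` and `Qᗮᗮ` are invariant) and
`x ∈ Q ⟺ P_{Qᗮ} x = 0` (`Submodule.orthogonal_orthogonal`).  `P_{Qᗮ} ∘ cls φ` is covariant, hence descends to `Ω(s_a, χ′_ξ)` (★ `TwistedCoinv.lift`); by the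
`U(H)(𝔸_f)`-equivariance of `cls φ` (★ `rightRegular_finAdelicToAdelic_toLp_lineThetaLift_tensor`) and `hsurj`, the kernel of the descended map is a
`Subrepresentation` of `Ω(s_a, χ′_ξ)`; it contains `mk Φ_f⁰` (membership in `Q`), and `mk Φ_f⁰ ≠ 0` because the non-zero `ψ`-class factors through `mk`;
«irreducible or zero» forces the kernel to be everything.

HONEST LABEL.  Nothing of [Liu2021] is asserted; HC_CM is proved only modulo the 7 printed citations (2 remaining: hLiu418 = stmt-HodgeConjecture-24832,
h413 = stmt-HodgeConjecture-24833) until rung 0 closes, and this file discharges none of them (a `--supports` helper toward brick (Gα-Cf) of line LD1).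

## References
* [Liu2021] Y. Liu, *Fourier–Jacobi cycles and arithmetic relative trace formula*, Camb. J. Math. 9 (2021) = arXiv:2102.11518, Def. 4.11 (l. 2090–2096);
  proof of Prop. 4.13 Case 1 (l. 2131–2137, p. 48); App. D §D.1 Step 3 (l. 5221).
* [Rallis1984] S. Rallis, *On the Howe duality conjecture*, Compositio Math. 51 (1984), proof of Thm. 1.2.2 p. 356.
* [MoeglinVignerasWaldspurger1987] C. Mœglin, M.-F. Vignéras, J.-L. Waldspurger, LNM 1291 (1987), Chap. 3 IV.4.
* [BorelJacquet1979] A. Borel, H. Jacquet, PSPM 33.1 (1979), §4.6.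
* [Dixmier1977] J. Dixmier, *C\*-algebras*, North-Holland (1977), §13.1.2 (closed invariant subspaces of unitary representations and their complements).
-/
set_option autoImplicit false
set_option linter.dupNamespace false

noncomputable section

open NumberField MeasureTheory IsDedekindDomain
open scoped Matrix Kronecker ComplexOrder ENNReal SchwartzMap TensorProduct Classical InnerProductSpace

namespace Summit.HodgeConjecture.HodgeConjecture.Cruxes.HLiu418.F0LD1ThetaFinGeneration

open _root_.MeasureTheory
open Literature.NumberTheory.Automorphic Literature.NumberTheory.Automorphic.UnitaryGroup
open Literature.NumberTheory.Automorphic.UnitaryGroup.CotangentForms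
open Literature.NumberTheory.Automorphic.IdeleClassGroup
open Literature.NumberTheory.Automorphic.Liu2021
open Literature.NumberTheory.Automorphic.Liu2021.Def411WeilCarriers
open Literature.NumberTheory.Automorphic.Liu2021.Def411WeilCarriersDoubling
open Literature.NumberTheory.GelbartRogawski1991 Literature.NumberTheory.GelbartRogawski1991.UnitaryDualPair
open Literature.NumberTheory.GelbartRogawski1991.UnitaryDualPair.WeilCoinv
open Literature.NumberTheory.Weil1964
open Literature.RepresentationTheory Literature.RepresentationTheory.Liu2021
open Literature.RepresentationTheory.CompactGroups
open Literature.RepresentationTheory.HeisenbergGroup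
open Summit.HodgeConjecture.HodgeConjecture.Cruxes.HLiu418.F0LD1ThetaTransportKit
open Summit.HodgeConjecture.HodgeConjecture.Cruxes.HLiu418.F0LD2ThetaTensorClasses
open Summit.HodgeConjecture.HodgeConjecture.Cruxes.HLiu418.F0LD1ThetaClassFinSliceFinite

section Core

variable (L : Type) [Field L] [NumberField L] [IsCMField L] (N : ℕ) (H : Matrix (Fin N) (Fin N) L)
  {n' : ℕ} (e₁ : Fin N × Fin 1 ≃ Fin n') (dV : Fin N → L) (hdV : ∀ i, IsCMField.complexConj L (dV i) = dV i)
  (hdV0 : ∀ i, dV i ≠ 0)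
  (ιA : (adelicGroupData (↥(maximalRealSubfield L)) L (IsCMField.complexConj L) N H).Adelic →* ↥(UnitaryGroup.adelic (↥(maximalRealSubfield L)) L (IsCMField.complexConj L) N (Matrix.diagonal dV)))
  (hιA : Continuous ιA ∧ ∀ ⦃γ : (adelicGroupData (↥(maximalRealSubfield L)) L (IsCMField.complexConj L) N H).Adelic⦄,
    γ ∈ (UnitaryGroup.toAdelic (↥(maximalRealSubfield L)) L (IsCMField.complexConj L) N H).range →
      ιA γ ∈ (UnitaryGroup.toAdelic (↥(maximalRealSubfield L)) L (IsCMField.complexConj L) N (Matrix.diagonal dV)).range)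
  (μ : Literature.NumberTheory.Automorphic.IdeleClassGroup L →ₜ* Circle) (hμ : IsConjugateSymplectic L μ) (a : (↥(maximalRealSubfield L))ˣ)
  (hρ : HasThetaMajorants fun
      (p : ↥(UnitaryGroup.adelic (↥(maximalRealSubfield L)) L (IsCMField.complexConj L) N (Matrix.diagonal dV)) × ↥(UnitaryGroup.adelic (↥(maximalRealSubfield L)) L (IsCMField.complexConj L) 1 (JW (↥(maximalRealSubfield L)) L a))) (Φ : piSchwartzBruhat (↥(maximalRealSubfield L)) (Fin n')) =>
        pairRep (↥(maximalRealSubfield L)) L (IsCMField.complexConj L) N 1 e₁ (Matrix.diagonal dV) (JW (↥(maximalRealSubfield L)) L a)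
          (chiSplittingLine L e₁ dV hdV hdV0 (toHeckeCharacter L μ) (isUnitary_toHeckeCharacter L μ)
            ((isOscillatorChar_toHeckeCharacter_iff μ).mpr hμ) (TW (↥(maximalRealSubfield L)) a)
            (isUnit_det_TW (↥(maximalRealSubfield L)) a) (JW (↥(maximalRealSubfield L)) L a) (JW_eq (↥(maximalRealSubfield L)) L a))
          p Φ)
  [CompactSpace (↥(UnitaryGroup.adelic (↥(maximalRealSubfield L)) L (IsCMField.complexConj L) N (Matrix.diagonal dV)) ⧸ (UnitaryGroup.toAdelic (↥(maximalRealSubfield L)) L (IsCMField.complexConj L) N (Matrix.diagonal dV)).range)] [MeasurableSpace (↥(UnitaryGroup.adelic (↥(maximalRealSubfield L)) L (IsCMField.complexConj L) 1 (JW (↥(maximalRealSubfield L)) L a)) ⧸ (UnitaryGroup.toAdelic (↥(maximalRealSubfield L)) L (IsCMField.complexConj L) 1 (JW (↥(maximalRealSubfield L)) L a)).range)] (μW : Measure (↥(UnitaryGroup.adelic (↥(maximalRealSubfield L)) L (IsCMField.complexConj L) 1 (JW (↥(maximalRealSubfield L)) L a)) ⧸ (UnitaryGroup.toAdelic (↥(maximalRealSubfield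 L)) L (IsCMField.complexConj L) 1 (JW (↥(maximalRealSubfield L)) L a)).range))
  [CompactSpace (adelicGroupData (↥(maximalRealSubfield L)) L (IsCMField.complexConj L) N H).automorphicQuotient]
  (ν : Measure (adelicGroupData (↥(maximalRealSubfield L)) L (IsCMField.complexConj L) N H).automorphicQuotient)
  [(adelicGroupData (↥(maximalRealSubfield L)) L (IsCMField.complexConj L) N H).IsAutomorphicMeasure ν]
  [BorelSpace (↥(UnitaryGroup.adelic (↥(maximalRealSubfield L)) L (IsCMField.complexConj L) 1 (JW (↥(maximalRealSubfield L)) L a)) ⧸ (UnitaryGroup.toAdelic (↥(maximalRealSubfield L)) L (IsCMField.complexConj L) 1 (JW (↥(maximalRealSubfield L)) L a)).range)] [IsFiniteMeasure μW]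
  [SMulInvariantMeasure ↥(UnitaryGroup.adelic (↥(maximalRealSubfield L)) L (IsCMField.complexConj L) 1 (JW (↥(maximalRealSubfield L)) L a)) (↥(UnitaryGroup.adelic (↥(maximalRealSubfield L)) L (IsCMField.complexConj L) 1 (JW (↥(maximalRealSubfield L)) L a)) ⧸ (UnitaryGroup.toAdelic (↥(maximalRealSubfield L)) L (IsCMField.complexConj L) 1 (JW (↥(maximalRealSubfield L)) L a)).range) μW]

include hιA

set_option maxHeartbeats 800000 in -- the `weilCoinv`/`finPairRep` telescope at the χ-splitting (as ★ `F0LD1ThetaClassFinSliceFinite` §2)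
/-- **FINITE-ADELIC GENERATION THROUGH A CLOSED INVARIANT SUBSPACE, from «irreducible or zero» of the coinvariants** (generic rank `N`,
abstract transport `ιA` whose finite part `k ↦ (ιA (1,k))_f` is finite-adelic (`hιAf`) and SURJECTIVE (`hsurj`)).  Let `ξ` be ANY continuous
unitary character of `[U(⟨a⟩)]` and suppose the `χ′_ξ`-coinvariants `Ω(s_a, χ′_ξ)` of the finite Weil representation of the pair
`U(diag dV) × U(⟨a⟩)` at the χ-splitting are «irreducible or zero» (`hirr`, the character-generic twin of ★
`isIrreducibleOrZero_rhoVAtLine_chiSplittingLine`).  If the finite datum `Φ_f⁰` carries a NON-ZERO class `[Θ̃_{R_e E(ψ ⊗ Φ_f⁰)}(ξ) ∘ ιA]` for some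
archimedean `ψ`, and `[Θ̃_{R_e E(φ ⊗ Φ_f⁰)}(ξ) ∘ ιA]` lies in a closed `R`-invariant subspace `Q ⊆ L²([U(H)])`, then `[Θ̃_{R_e E(φ ⊗ Φ_f)}(ξ) ∘ ιA] ∈ Q`
for EVERY `Φ_f`.  PROOF: the class map `T : Φ_f ↦ [Θ̃_{R_e E(φ ⊗ Φ_f)}(ξ) ∘ ιA]` is linear and `χ′_ξ`-covariant (★ `toLp_lineThetaLift_tensor_add ∕ _smul`,
★ `toLp_lineThetaLift_tensor_finPairRep_one_charCM`), so `P_{Qᗮ} ∘ T` descends to `Ω(s_a, χ′_ξ)` (★ `TwistedCoinv.lift`); `P_{Qᗮ}` commutes with `R`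
(both `Q` and `Qᗮ` are invariant, `R` unitary ★ `isUnitary_rightRegular`) and `T` is `U(H)(𝔸_f)`-equivariant (★
`rightRegular_finAdelicToAdelic_toLp_lineThetaLift_tensor`), so the kernel of the descended map is a subrepresentation of `Ω(s_a, χ′_ξ)` (surjectivity
of the finite transport); it contains `mk Φ_f⁰ ≠ 0` (the class for `ψ` factors through `mk`), hence is everything.
[cite: Liu2021, Def. 4.11 (l. 2092–2096); proof of Prop. 4.13 Case 1 (l. 2136–2137); App. D §D.1 Step 3 (l. 5221)] [cite: Rallis1984, proof of Thm. 1.2.2 p. 356]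
[cite: MoeglinVignerasWaldspurger1987, Chap. 3 IV.4] -/
theorem toLp_lineThetaLift_tensor_mem_of_isIrreducibleOrZero
    (ξ : haveI := normal_range_toAdelic_JW L a
      PontryaginDual (↥(UnitaryGroup.adelic (↥(maximalRealSubfield L)) L (IsCMField.complexConj L) 1 (JW (↥(maximalRealSubfield L)) L a)) ⧸ (UnitaryGroup.toAdelic (↥(maximalRealSubfield L)) L (IsCMField.complexConj L) 1 (JW (↥(maximalRealSubfield L)) L a)).range))
    (hirr : ∀ (χ' : finAdelic (↥(maximalRealSubfield L)) L (IsCMField.complexConj L) 1 (JW (↥(maximalRealSubfield L)) L a) →* ℂˣ),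
      (∀ g, ‖((χ' g : ℂˣ) : ℂ)‖ = 1) → Continuous χ' →
      IsIrreducibleOrZero (weilCoinv (↥(maximalRealSubfield L)) L (IsCMField.complexConj L) N 1 e₁ (Matrix.diagonal dV)
        (JW (↥(maximalRealSubfield L)) L a) (complexConj_imagUnit L) (imagUnit_ne_zero L) (imagUnit_mul_self L) (realDiagonal_isSymm L dV hdV)
        (isSymm_TW (↥(maximalRealSubfield L)) a) (isUnit_det_realDiagonal L dV hdV hdV0) (isUnit_det_TW (↥(maximalRealSubfield L)) a)
        (realDiagonal_map L dV hdV).symm (JW_eq (↥(maximalRealSubfield L)) L a) χ'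
        (isCompatible_chiSplittingLine L e₁ dV hdV hdV0 (toHeckeCharacter L μ) (isUnitary_toHeckeCharacter L μ)
          ((isOscillatorChar_toHeckeCharacter_iff μ).mpr hμ) (TW (↥(maximalRealSubfield L)) a) (isSymm_TW (↥(maximalRealSubfield L)) a)
          (isUnit_det_TW (↥(maximalRealSubfield L)) a) (JW (↥(maximalRealSubfield L)) L a) (JW_eq (↥(maximalRealSubfield L)) L a))))
    (hιAf : ∀ k, ιA (finAdelicToAdelic (↥(maximalRealSubfield L)) L (IsCMField.complexConj L) N H k) =
      finAdelicToAdelic (↥(maximalRealSubfield L)) L (IsCMField.complexConj L) N (Matrix.diagonal dV)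
        (finPart (↥(maximalRealSubfield L)) L (IsCMField.complexConj L) N (Matrix.diagonal dV)
          (ιA (finAdelicToAdelic (↥(maximalRealSubfield L)) L (IsCMField.complexConj L) N H k))))
    (hsurj : Function.Surjective fun k : finAdelic (↥(maximalRealSubfield L)) L (IsCMField.complexConj L) N H =>
      finPart (↥(maximalRealSubfield L)) L (IsCMField.complexConj L) N (Matrix.diagonal dV)
        (ιA (finAdelicToAdelic (↥(maximalRealSubfield L)) L (IsCMField.complexConj L) N H k)))
    (ψ φ : 𝓢(((Fin N × Fin 1) → NumberField.mixedEmbedding.mixedSpace ↥(maximalRealSubfield L)), ℂ))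
    (Φf₀ : FinSB (↥(maximalRealSubfield L)) (Fin N × Fin 1))
    (hne : haveI := normal_range_toAdelic_JW L a
      MemLp.toLp _ (memLp_toQuotFun_lineThetaLift L N H e₁ dV hdV hdV0 ιA hιA μ hμ a hρ μW
        (piSBReindex (↥(maximalRealSubfield L)) e₁ (piSchwartzBruhatEquiv (↥(maximalRealSubfield L)) (Fin N × Fin 1) (ψ ⊗ₜ[ℂ] Φf₀)))
        (charCM ξ) ν 2) ≠ 0)
    (Q : ContRepresentation.ClosedSubrep ((adelicGroupData (↥(maximalRealSubfield L)) L (IsCMField.complexConj L) N H).rightRegular ν))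
    (hmem : haveI := normal_range_toAdelic_JW L a
      MemLp.toLp _ (memLp_toQuotFun_lineThetaLift L N H e₁ dV hdV hdV0 ιA hιA μ hμ a hρ μW
        (piSBReindex (↥(maximalRealSubfield L)) e₁ (piSchwartzBruhatEquiv (↥(maximalRealSubfield L)) (Fin N × Fin 1) (φ ⊗ₜ[ℂ] Φf₀)))
        (charCM ξ) ν 2) ∈ Q)
    (Φf : FinSB (↥(maximalRealSubfield L)) (Fin N × Fin 1)) :
    haveI := normal_range_toAdelic_JW L a
    MemLp.toLp _ (memLp_toQuotFun_lineThetaLift L N H e₁ dV hdV hdV0 ιA hιA μ hμ a hρ μW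
        (piSBReindex (↥(maximalRealSubfield L)) e₁ (piSchwartzBruhatEquiv (↥(maximalRealSubfield L)) (Fin N × Fin 1) (φ ⊗ₜ[ℂ] Φf)))
        (charCM ξ) ν 2) ∈ Q := by
  haveI := normal_range_toAdelic_JW L a
  -- the finite Weil representation at the χ-splitting of the line `⟨a⟩` (abbreviated through its `hs`)
  have hs := isCompatible_chiSplittingLine L e₁ dV hdV hdV0 (toHeckeCharacter L μ) (isUnitary_toHeckeCharacter L μ)
    ((isOscillatorChar_toHeckeCharacter_iff μ).mpr hμ) (TW (↥(maximalRealSubfield L)) a) (isSymm_TW (↥(maximalRealSubfield L)) a)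
    (isUnit_det_TW (↥(maximalRealSubfield L)) a) (JW (↥(maximalRealSubfield L)) L a) (JW_eq (↥(maximalRealSubfield L)) L a)
  -- (1) the character `χ′_ξ(u) = ξ([u])` of `U(⟨a⟩)(𝔸_{L⁺,f})`: unitary and continuous (as in ★ `F0LD1ThetaClassFinSliceFinite` §2)
  set χ' : finAdelic (↥(maximalRealSubfield L)) L (IsCMField.complexConj L) 1 (JW (↥(maximalRealSubfield L)) L a) →* ℂˣ :=
    Circle.toUnits.comp ((ξ : _ →ₜ* Circle).toMonoidHom.comp ((QuotientGroup.mk' _).comp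
      (finAdelicToAdelic (↥(maximalRealSubfield L)) L (IsCMField.complexConj L) 1 (JW (↥(maximalRealSubfield L)) L a)))) with hχ'
  have hχ'v : ∀ u, ((χ' u : ℂˣ) : ℂ) =
      ((ξ (QuotientGroup.mk (finAdelicToAdelic (↥(maximalRealSubfield L)) L (IsCMField.complexConj L) 1 (JW (↥(maximalRealSubfield L)) L a) u)) : Circle) : ℂ) :=
    fun u => rfl
  have hχ'n : ∀ u, ‖((χ' u : ℂˣ) : ℂ)‖ = 1 := fun u => by
    rw [hχ'v]
    exact Circle.norm_coe _
  have hcont : Continuous fun u => ((χ' u : ℂˣ) : ℂ) := by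
    simp_rw [hχ'v]
    exact continuous_subtype_val.comp ((ξ : _ →ₜ* Circle).continuous.comp
      (continuous_quot_mk.comp (continuous_finAdelicToAdelic (↥(maximalRealSubfield L)) L (IsCMField.complexConj L) 1 _)))
  have hχ'c : Continuous χ' := by
    refine Units.continuous_iff.2 ⟨hcont, ?_⟩
    have hinv : (fun u => ((χ' u)⁻¹ : ℂˣ).val) = fun u => ((χ' u⁻¹ : ℂˣ) : ℂ) := by
      funext u; rw [map_inv]
    rw [hinv]
    exact hcont.comp continuous_inv
  -- (2) the class maps `Φ_f ↦ [Θ̃_{R_e E(φ ⊗ Φ_f)}(ξ) ∘ ιA]` (for `φ` and for `ψ`): linear and `χ′_ξ`-covariant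
  let cls : 𝓢(((Fin N × Fin 1) → NumberField.mixedEmbedding.mixedSpace ↥(maximalRealSubfield L)), ℂ) →
      FinSB (↥(maximalRealSubfield L)) (Fin N × Fin 1) →ₗ[ℂ] ↥(Lp ℂ 2 ν) := fun φ' =>
    { toFun := fun Φf' => MemLp.toLp _ (memLp_toQuotFun_lineThetaLift L N H e₁ dV hdV hdV0 ιA hιA μ hμ a hρ μW
        (piSBReindex (↥(maximalRealSubfield L)) e₁ (piSchwartzBruhatEquiv (↥(maximalRealSubfield L)) (Fin N × Fin 1) (φ' ⊗ₜ[ℂ] Φf'))) (charCM ξ) ν 2)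
      map_add' := fun Φf₁ Φf₂ => toLp_lineThetaLift_tensor_add L N H e₁ dV hdV hdV0 ιA hιA μ hμ a hρ μW (charCM ξ) φ' ν Φf₁ Φf₂
      map_smul' := fun c Φf' => toLp_lineThetaLift_tensor_smul L N H e₁ dV hdV hdV0 ιA hιA μ hμ a hρ μW (charCM ξ) φ' ν c Φf' }
  have hcls : ∀ φ' Φf', cls φ' Φf' = MemLp.toLp _ (memLp_toQuotFun_lineThetaLift L N H e₁ dV hdV hdV0 ιA hιA μ hμ a hρ μW
        (piSBReindex (↥(maximalRealSubfield L)) e₁ (piSchwartzBruhatEquiv (↥(maximalRealSubfield L)) (Fin N × Fin 1) (φ' ⊗ₜ[ℂ] Φf'))) (charCM ξ) ν 2) :=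
    fun _ _ => rfl
  have hcov : ∀ φ' (u : finAdelic (↥(maximalRealSubfield L)) L (IsCMField.complexConj L) 1 (JW (↥(maximalRealSubfield L)) L a))
      (Φf' : FinSB (↥(maximalRealSubfield L)) (Fin N × Fin 1)),
      cls φ' (finPairRep (↥(maximalRealSubfield L)) L (IsCMField.complexConj L) N 1 e₁ (Matrix.diagonal dV) (JW (↥(maximalRealSubfield L)) L a)
        (complexConj_imagUnit L) (imagUnit_ne_zero L) (imagUnit_mul_self L) (realDiagonal_isSymm L dV hdV) (isSymm_TW (↥(maximalRealSubfield L)) a)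
        (isUnit_det_realDiagonal L dV hdV hdV0) (isUnit_det_TW (↥(maximalRealSubfield L)) a) (realDiagonal_map L dV hdV).symm
        (JW_eq (↥(maximalRealSubfield L)) L a) hs (1, u) Φf') = ((χ' u : ℂˣ) : ℂ) • cls φ' Φf' := fun φ' u Φf' => by
    rw [hcls, hcls, hχ'v]
    exact toLp_lineThetaLift_tensor_finPairRep_one_charCM L N H e₁ dV hdV hdV0 ιA hιA μ hμ a hρ μW φ' ν ξ u Φf'
  -- (3) the right regular representation is unitary; the orthogonal projection onto `Qᗮ` commutes with it and detects membership in `Q`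
  have hU : ((adelicGroupData (↥(maximalRealSubfield L)) L (IsCMField.complexConj L) N H).rightRegular ν).IsUnitary :=
    (adelicGroupData (↥(maximalRealSubfield L)) L (IsCMField.complexConj L) N H).isUnitary_rightRegular ν
  set Qo : ContRepresentation.ClosedSubrep ((adelicGroupData (↥(maximalRealSubfield L)) L (IsCMField.complexConj L) N H).rightRegular ν) :=
    Q.orthogonal hU with hQo
  have hproj : ∀ (γ : (adelicGroupData (↥(maximalRealSubfield L)) L (IsCMField.complexConj L) N H).Adelic) (x : ↥(Lp ℂ 2 ν)),
      Qo.toSubmodule.starProjection ((adelicGroupData (↥(maximalRealSubfield L)) L (IsCMField.complexConj L) N H).rightRegular ν γ x) =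
        (adelicGroupData (↥(maximalRealSubfield L)) L (IsCMField.complexConj L) N H).rightRegular ν γ (Qo.toSubmodule.starProjection x) := by
    intro γ x
    apply Submodule.eq_starProjection_of_mem_orthogonal
    · exact Qo.apply_mem γ (Submodule.starProjection_apply_mem _ x)
    · rw [← map_sub]
      exact (Qo.orthogonal hU).apply_mem γ (Submodule.sub_starProjection_mem_orthogonal x)
  have hmemQ : ∀ x : ↥(Lp ℂ 2 ν), x ∈ Q ↔ Qo.toSubmodule.starProjection x = 0 := by
    intro x
    rw [Submodule.starProjection_apply_eq_zero_iff, hQo, ContRepresentation.ClosedSubrep.toSubmodule_orthogonal,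
      Submodule.orthogonal_orthogonal]
    rfl
  -- (4) `P_{Qᗮ} ∘ cls φ` is covariant, hence descends to the coinvariants `Ω(s_a, χ′_ξ)`
  let T : FinSB (↥(maximalRealSubfield L)) (Fin N × Fin 1) →ₗ[ℂ] ↥(Lp ℂ 2 ν) :=
    (Qo.toSubmodule.starProjection : ↥(Lp ℂ 2 ν) →L[ℂ] ↥(Lp ℂ 2 ν)).toLinearMap ∘ₗ cls φ
  have hT : ∀ Φf', T Φf' = Qo.toSubmodule.starProjection (cls φ Φf') := fun _ => rfl
  have hTcov : ∀ (u : finAdelic (↥(maximalRealSubfield L)) L (IsCMField.complexConj L) 1 (JW (↥(maximalRealSubfield L)) L a))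
      (Φf' : FinSB (↥(maximalRealSubfield L)) (Fin N × Fin 1)),
      T (finPairRepW (↥(maximalRealSubfield L)) L (IsCMField.complexConj L) N 1 e₁ (Matrix.diagonal dV) (JW (↥(maximalRealSubfield L)) L a)
        (complexConj_imagUnit L) (imagUnit_ne_zero L) (imagUnit_mul_self L) (realDiagonal_isSymm L dV hdV) (isSymm_TW (↥(maximalRealSubfield L)) a)
        (isUnit_det_realDiagonal L dV hdV hdV0) (isUnit_det_TW (↥(maximalRealSubfield L)) a) (realDiagonal_map L dV hdV).symm
        (JW_eq (↥(maximalRealSubfield L)) L a) hs u Φf') = ((χ' u : ℂˣ) : ℂ) • T Φf' := fun u Φf' => by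
    rw [hT, hT, finPairRepW_apply, hcov φ u Φf', map_smul]
  let Tbar := TwistedCoinv.lift (finPairRepW (↥(maximalRealSubfield L)) L (IsCMField.complexConj L) N 1 e₁ (Matrix.diagonal dV)
      (JW (↥(maximalRealSubfield L)) L a) (complexConj_imagUnit L) (imagUnit_ne_zero L) (imagUnit_mul_self L) (realDiagonal_isSymm L dV hdV)
      (isSymm_TW (↥(maximalRealSubfield L)) a) (isUnit_det_realDiagonal L dV hdV hdV0) (isUnit_det_TW (↥(maximalRealSubfield L)) a)
      (realDiagonal_map L dV hdV).symm (JW_eq (↥(maximalRealSubfield L)) L a) hs) χ' T hTcov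
  have hTbar : ∀ Φf', Tbar (TwistedCoinv.mk _ χ' Φf') = Qo.toSubmodule.starProjection (cls φ Φf') := fun Φf' =>
    (TwistedCoinv.lift_mk _ χ' T hTcov Φf').trans (hT Φf')
  -- (5) `U(H)(𝔸_f)`-EQUIVARIANCE of `cls φ` through the finite part of `ιA`
  have heqv : ∀ (k : finAdelic (↥(maximalRealSubfield L)) L (IsCMField.complexConj L) N H) (Φf' : FinSB (↥(maximalRealSubfield L)) (Fin N × Fin 1)),
      cls φ (finPairRep (↥(maximalRealSubfield L)) L (IsCMField.complexConj L) N 1 e₁ (Matrix.diagonal dV) (JW (↥(maximalRealSubfield L)) L a)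
          (complexConj_imagUnit L) (imagUnit_ne_zero L) (imagUnit_mul_self L) (realDiagonal_isSymm L dV hdV) (isSymm_TW (↥(maximalRealSubfield L)) a)
          (isUnit_det_realDiagonal L dV hdV hdV0) (isUnit_det_TW (↥(maximalRealSubfield L)) a) (realDiagonal_map L dV hdV).symm
          (JW_eq (↥(maximalRealSubfield L)) L a) hs
          ((finPart (↥(maximalRealSubfield L)) L (IsCMField.complexConj L) N (Matrix.diagonal dV)
            (ιA (finAdelicToAdelic (↥(maximalRealSubfield L)) L (IsCMField.complexConj L) N H k))), 1) Φf') =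
        (adelicGroupData (↥(maximalRealSubfield L)) L (IsCMField.complexConj L) N H).rightRegular ν
          (finAdelicToAdelic (↥(maximalRealSubfield L)) L (IsCMField.complexConj L) N H k) (cls φ Φf') := fun k Φf' => by
    rw [hcls, hcls]
    exact (rightRegular_finAdelicToAdelic_toLp_lineThetaLift_tensor L N H e₁ dV hdV hdV0 ιA hιA μ hμ a hρ μW (charCM ξ) φ ν hιAf k Φf').symm
  -- (6) the kernel of `Tbar` is a subrepresentation of `Ω(s_a, χ′_ξ)`
  let W : Subrepresentation (weilCoinv (↥(maximalRealSubfield L)) L (IsCMField.complexConj L) N 1 e₁ (Matrix.diagonal dV)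
        (JW (↥(maximalRealSubfield L)) L a) (complexConj_imagUnit L) (imagUnit_ne_zero L) (imagUnit_mul_self L) (realDiagonal_isSymm L dV hdV)
        (isSymm_TW (↥(maximalRealSubfield L)) a) (isUnit_det_realDiagonal L dV hdV hdV0) (isUnit_det_TW (↥(maximalRealSubfield L)) a)
        (realDiagonal_map L dV hdV).symm (JW_eq (↥(maximalRealSubfield L)) L a) χ' hs) :=
    { toSubmodule := LinearMap.ker Tbar
      apply_mem_toSubmodule := fun k' x hx => by
        rw [LinearMap.mem_ker] at hx ⊢
        obtain ⟨Φf', rfl⟩ := TwistedCoinv.mk_surjective _ _ x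
        obtain ⟨k, hk⟩ := hsurj k'
        rw [weilCoinv_mk, hTbar, ← hk, heqv k Φf', hproj, ← hTbar, hx, map_zero] }
  -- (7) `mk Φ_f⁰ ∈ W` and `mk Φ_f⁰ ≠ 0`
  have hmem₀ : TwistedCoinv.mk _ χ' Φf₀ ∈ W.toSubmodule := by
    change TwistedCoinv.mk _ χ' Φf₀ ∈ LinearMap.ker Tbar
    rw [LinearMap.mem_ker, hTbar, ← hmemQ]
    exact hmem
  have hne₀ : TwistedCoinv.mk (finPairRepW (↥(maximalRealSubfield L)) L (IsCMField.complexConj L) N 1 e₁ (Matrix.diagonal dV)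
      (JW (↥(maximalRealSubfield L)) L a) (complexConj_imagUnit L) (imagUnit_ne_zero L) (imagUnit_mul_self L) (realDiagonal_isSymm L dV hdV)
      (isSymm_TW (↥(maximalRealSubfield L)) a) (isUnit_det_realDiagonal L dV hdV hdV0) (isUnit_det_TW (↥(maximalRealSubfield L)) a)
      (realDiagonal_map L dV hdV).symm (JW_eq (↥(maximalRealSubfield L)) L a) hs) χ' Φf₀ ≠ 0 := by
    intro h0
    apply hne
    -- the class for `ψ` factors through `mk`
    have hψ := TwistedCoinv.lift_mk _ χ' (cls ψ) (fun u Φf' => by rw [finPairRepW_apply]; exact hcov ψ u Φf') Φf₀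
    rw [h0, map_zero] at hψ
    rw [← hcls ψ Φf₀]
    exact hψ.symm
  -- (8) «irreducible or zero»: `W = ⊤`
  have hW : W = ⊤ := by
    rcases hirr χ' hχ'n hχ'c W with h | h
    · exfalso
      have hb : W.toSubmodule = ⊥ := congrArg Subrepresentation.toSubmodule h
      rw [hb, Submodule.mem_bot] at hmem₀
      exact hne₀ hmem₀
    · exact h
  -- (9) conclusion
  have hall : TwistedCoinv.mk _ χ' Φf ∈ W.toSubmodule := by
    rw [congrArg Subrepresentation.toSubmodule hW]
    exact Submodule.mem_top
  change TwistedCoinv.mk _ χ' Φf ∈ LinearMap.ker Tbar at hall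
  rw [LinearMap.mem_ker, hTbar] at hall
  rw [← hcls φ Φf, hmemQ]
  exact hall

end Core

end Summit.HodgeConjecture.HodgeConjecture.Cruxes.HLiu418.F0LD1ThetaFinGeneration

end
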